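import Summits.BirchSwinnertonDyer.BirchSwinnertonDyer.Theorems.QuadraticBranchSignedControlPlusEtaNonsurjThetaFunctionalEquationNormCoordinateSqueezeRoad
import HarnessLib

/-!
# Route `QuadraticBranchSignedControl` (rung K8, cell `bsd-potss`), residual crux `PlusEtaMainConjectureNonsurj`
# (stmt-BirchSwinnertonDyer-19606): THE FUNCTIONAL EQUATION ON THE QUADRATIC BRANCH, XXXVIII — THE `η`-RANK BOUND OFF THE ONTO LOCUS
# (**`T^{rank V^{(p*)}(ℚ)} ∣ Char X⁺(V/K_∞)^η` with NO surjectivity hypothesis**, from the `pⁿ`-clause of Kobayashi's Thm. 1.3 and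
# `coeff_{rank V} L_p⁺(V) ≠ 0`), the `r₀`-PART OF (C1⁺_η) ON A NON-ONTO ROW (`ord_T Char = ord_T L_p⁺(V,η,X)`), and **(C1⁺_η) UP TO A POWER
# OF `p` AT A NON-ONTO PAIR** from Kim 3.11η + an irreducible norm shape + one algebraic zero pair (seat `bsd-potss-k8eta-c2` g31; kernel;
# CONDITIONAL on Kobayashi 1.2 / 1.3 / 2.2η / 4.1η and Kim 3.11η in hypothesis position)

WHY. Every road of the K8 block that bounds `ord_T` of the `η`-characteristic series from below (k8eta-c1 g3's `η`-rank bound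
`X_pow_twistRank_dvd_etaCharGenerator_of_namedFacts_of_certV`, hence g10/g11's squeezes and Part XXXVI) assumes the `p`-adic TOWER ONTO:
Kobayashi's Thm. 1.3 then puts `L_p⁺(V)` itself in `Char X⁺(V/ℚ_∞)`, and with the `V`-certificate `ξ_ℚ = T^{rank V}·unit` cancels out of
`T^{rank V + rank W} ∣ ξ_ℚ·ξ_η`. Crux 19606 is about the rows where the tower is NOT onto. OBSERVATION: only ORDERS are needed. The `pⁿ`-clause
of Thm. 1.3 (no surjectivity) gives `ξ_ℚ ∣ pⁿ·L_p⁺(V)`, so `ord_T ξ_ℚ ≤ ord_T L_p⁺(V) ≤ rank V` as soon as `coeff_{rank V} L_p⁺(V) ≠ 0` (weaker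
than the unit certificate), while the signed rank bound over `F = ℚ(√p*)` gives `rank V + rank W ≤ ord_T ξ_ℚ + ord_T ξ_η`; hence
**`ord_T ξ_η ≥ rank W`, i.e. `T^{rank W} ∣ ξ_η`, on EVERY good `a_p = 0` row, onto or not** (§112). With Kobayashi's Thm. 4.1η `pⁿ`-clause
(`ξ_η ∣ pⁿ·Lη`): `ord_T ξ_η ≤ ord_T Lη`; so if the branch function vanishes to order EXACTLY `rank W` at `T = 0` (a numerical certificate:
`coeff_{rank W} Lη ≠ 0`), **`ord_T Char X^η = rank W = ord_T Lη` — the `r₀`-part of the main conjecture at a non-onto row** (§113). Finally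
Part XXXV's slack brick turns Kim 3.11η + the irreducible norm shape `Lη = u·T^{rank W}(1+T)^k H(Z)` + ONE algebraic zero pair
(`rank W < λ(ξ_η)`) into **`Char X^η = (p^m·Lη)` with `m = μ(ξ_η) ≤ n`** (§114): on such a row the `η`-main conjecture holds up to the power
`p^{μ_alg}`, and (C1⁺_η) there ⟺ `μ_alg = 0` (the analytic `μ` being `0` by the shape).

MATHEMATICS. (§112) g3's decomposition frame verbatim (`etaDecomposition`, the dual datum of `Sel⁺(V'/F_∞)` on `X⁺(V/ℚ_∞) × X_η`,
`Char = (ξ_ℚ·g)`, `X_pow_mordellWeilRank_dvd_of_charIdeal_eq_span`, `rank V'(F) = rank V + rank W`), then ORDERS: `X^{rank V + rank W} ∣ ξg`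
⟹ `rank V + rank W ≤ ord ξ + ord g`; `ξ ∣ pⁿL_p⁺(V)` and `coeff_{rank V} ≠ 0` ⟹ `ord ξ ≤ rank V`; so `ord g ≥ rank W`, `g = T^{ord g}·D`.
(§113) `g ∣ pⁿLη` ⟹ `ord g ≤ ord Lη` (Part XXXII `order_toNat_le_of_dvd`). (§114) Part XXXV `span_eq_C_pow_mul_of_normShape_of_irreducible_of_lt_lam`.

WHAT (5 theorems; all but `order_natCast_pow_mul` CONDITIONAL on the displayed named facts). §112 `order_natCast_pow_mul`,
**`X_pow_twistRank_dvd_etaCharGenerator_of_namedFacts_of_coeff_ne_zero`** (no `hsurj`); §113 **`order_etaCharGenerator_eq_twistRank_of_namedFacts`**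
(`r₀`-part at any row); §114 **`etaCharIdeal_eq_span_C_pow_mul_of_namedFacts_of_invol_of_normShape_of_lt_lam`** ((C1⁺_η) up to `p^{μ_alg}` at any
row, incl. non-onto), `etaCharIdeal_eq_span_of_namedFacts_of_invol_of_normShape_of_lt_lam_of_mu` (`μ_alg = 0` ⟹ the datum's `Char = (Lη)`).

HONEST FRAMING (cell `bsd-potss`; FULL-BSD rank ≤ 1 programme, HUMAN RULING D-0036/D-0074): TOOL THEOREMS ONLY, CONDITIONAL on the named Literature
facts in hypothesis position (Kobayashi 2003 Thm. 1.2 / 1.3 / 2.2η / 4.1η; B. D. Kim 2008 Thm. 3.11η in §114), on the per-pair certificate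
`coeff_{rank V} L_p⁺(V) ≠ 0`, the per-pair analytic shape / order certificate and the per-pair algebraic input `rank W < λ(Char X^η)` (supplied here
for NO pair). `μ_alg = 0` on a non-onto row is NOT claimed (it is exactly what is left). No definition, no named fact minted, no `sorry`, axioms standard;
crux 19606 and the route OPEN; nothing booked; `BSD(W, p)` claimed for no pair. `--supports stmt-BirchSwinnertonDyer-19606`.

References: [Kobayashi2003] Thm. 1.2 / 1.3 (p. 2), Thm. 2.2 (p. 5), §4 + Thm. 4.1 (p. 8); [KimBD2008MRL] Thm. 3.11 (p. 93); [GreenbergLNM1716] §1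
p. 65, §3 Lemma 3.1; [Washington1997] §7.1, §13.2. Tree: k8eta-c1 g3 `…PlusEtaLowerInclusionValuationSqueeze` (§2, copied with the order argument
in place of the onto cancellation); Parts XXXII, XXXV.
-/

set_option autoImplicit false
set_option linter.dupNamespace false
noncomputable section

open scoped Classical

open CongruenceSubgroup Field WeierstrassCurve
open Literature.NumberTheory.EllipticCurves
open Literature.NumberTheory.EllipticCurves.ModularForms
open Literature.NumberTheory.GaloisRepresentations
open Literature.NumberTheory.EllipticCurves.IwasawaAlgebra
open Summit.BirchSwinnertonDyer.Rank1Residual.Additive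
open Summit.BirchSwinnertonDyer.Rank1Residual.X1.MuLambda (mu lam)

namespace Summit.BirchSwinnertonDyer.BirchSwinnertonDyer.Theorems.EtaThetaFunctionalEquation

/-! ## §112 The `η`-rank bound without surjectivity -/

section Pair

variable {V : WeierstrassCurve ℚ} [V.IsElliptic] [V.IsGloballyMinimal] {p : ℕ} [hp : Fact p.Prime]

/-- `ord_T(pⁿ·f) = ord_T f`. [folklore] -/
theorem order_natCast_pow_mul (n : ℕ) (f : IwasawaAlgebra p) :
    PowerSeries.order ((p : IwasawaAlgebra p) ^ n * f) = PowerSeries.order f := by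
  have hC : PowerSeries.order (PowerSeries.C ((p : ℤ_[p]) ^ n) : IwasawaAlgebra p) = 0 := by
    refine PowerSeries.order_eq_nat.mpr ⟨?_, fun i hi ↦ (Nat.not_lt_zero i hi).elim⟩
    rw [PowerSeries.coeff_zero_eq_constantCoeff, PowerSeries.constantCoeff_C]
    exact pow_ne_zero n (Nat.cast_ne_zero.mpr hp.out.ne_zero)
  rw [natCast_pow_eq_C_pow, PowerSeries.order_mul, hC, zero_add]

set_option maxHeartbeats 400000 in
/-- **THE `η`-RANK BOUND OFF THE ONTO LOCUS.** On ANY good `a_p = 0` pair `(V, p)`, `p ≥ 5` — tower onto OR NOT — GRANTED Kobayashi's Thm. 1.2,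
Thm. 1.3 (its `pⁿ`-clause only) and Thm. 2.2 at `η` (NAMED facts, hypothesis position), and a plus function `L_p⁺(V)` of the newform with
**`coeff_{rank V(ℚ)} L_p⁺(V) ≠ 0`** (weaker than the unit certificate): every characteristic power series `g` of every `η`-datum is divisible by
**`T^{rank V^{(p*)}(ℚ)}`**. Chain: g3's decomposition frame (`Char X⁺(V'/F_∞) = (ξ_ℚ·g)`, signed rank bound over `F`,
`rank V'(F) = rank V + rank V^{(p*)}`) ⟹ `rank V + rank W ≤ ord ξ_ℚ + ord g`; `ξ_ℚ ∣ pⁿL_p⁺(V)` ⟹ `ord ξ_ℚ ≤ ord L_p⁺(V) ≤ rank V`. CONDITIONAL;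
asserts nothing class-wide. [cite: Kobayashi2003, Thm. 1.2 and Thm. 1.3 (p. 2), Thm. 2.2 (p. 5), §4 (p. 8)]
[cite: GreenbergLNM1716, §1 p. 65 and §3 Lemma 3.1 (easy half of control)] -/
theorem X_pow_twistRank_dvd_etaCharGenerator_of_namedFacts_of_coeff_ne_zero
    (h12 : Kobayashi2003.thm12_signedSelmerDual_finite_torsion)
    (h13 : Kobayashi2003.thm41_signedCharIdeal_divisibility)
    (h22 : Kobayashi2003.thm22_etaSignedSelmerDual_finite_torsion)
    (hp5 : 5 ≤ p) (hgood : V.HasGoodReductionAtPrime p) (hap : V.frobeniusTrace p = 0)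
    (hcertV : ∀ {N : ℕ} [NeZero N] (f : CuspForm (Gamma0 N) 2), IsNewformOf V f →
      ∃ L : IwasawaAlgebra p, Kobayashi2003.IsSignedPAdicLFunction f p 1 L ∧
        PowerSeries.coeff V.mordellWeilRank L ≠ 0)
    {N : ℕ} [NeZero N] {f : CuspForm (Gamma0 N) 2} (hf : IsNewformOf V f)
    (K₀ : Type) [Field K₀] [NumberField K₀] [IsCyclotomicExtension {p} ℚ K₀]
    [(galRange (K := ℚ) K₀).Normal] (ηq : absoluteGaloisGroup ℚ →* ℤˣ)
    (hηK : ∀ σ ∈ galRange (K := ℚ) K₀, ηq σ = 1) (hη1 : ηq ≠ 1)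
    (κ : ZpExtension ℚ p) (γ : absoluteGaloisGroup ℚ) (hκ : κ.IsCyclotomic) (hγ : κ.IsTopGenerator γ)
    (hγK : γ ∈ galRange (K := ℚ) K₀) (hγc : IsCyclotomicVariable p γ)
    (D : EtaSignedSelmerDualData V κ K₀ ℚ_[p] ηq γ 1) {g : IwasawaAlgebra p}
    (hg : D.charIdeal = Ideal.span {g}) :
    (PowerSeries.X : IwasawaAlgebra p) ^ (V.quadraticTwist ((-1) ^ (p / 2) * p)).mordellWeilRank ∣ g := by
  have hp2 : p ≠ 2 := by omega
  obtain ⟨F, _instF, _instNF, V', _instE, κF, γF, Φ, hF2, hθ, hCV, hκF, hγF, hζ, hΦ⟩ :=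
    etaDecomposition p hp5 K₀ ηq hηK hη1 V hgood hap κ γ hκ hγ hγK hγc
  -- Kobayashi's dual datum of `Sel⁺(V/ℚ_∞)` at `γ` (EXISTS), finitely generated torsion by Thm. 1.2
  let D₀ : Kobayashi2003.SignedSelmerDualData V κ γ 1 := Kobayashi2003.signedSelmerDualData V κ 1 hγ
  obtain ⟨h0fin, h0tor⟩ := h12 V p hp2 hgood hap κ γ hκ hγ 1 D₀
  haveI : Module.Finite (IwasawaAlgebra p) D₀.X := h0fin
  -- the `η`-datum is finitely generated torsion by Thm. 2.2 at `η`
  obtain ⟨hfin, htor⟩ :=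
    EtaSignedSelmerDualData.finite_isTorsion_of_thm22 h22 hηK hp2 hgood hap hκ hγ hγK D
  haveI : Module.Finite (IwasawaAlgebra p) D.X := hfin
  -- the two projections of the decomposition
  let π₀ : Kobayashi2003.signedSelmerInfty V' κF 1 →+ Kobayashi2003.signedSelmerInfty V κ 1 :=
    (AddMonoidHom.fst _ _).comp Φ.toAddMonoidHom
  let π₁ : Kobayashi2003.signedSelmerInfty V' κF 1 →+ towerSignedSelmerInftyEta V κ K₀ ℚ_[p] ηq 1 :=
    (AddMonoidHom.snd _ _).comp Φ.toAddMonoidHom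
  -- the character group of the direct sum (verbatim from `etaTransportPlus_of_decomposition`)
  let T : D₀.X × D.X →+ (Kobayashi2003.signedSelmerInfty V' κF 1 →+ AddCircle (1 : ℚ)) :=
    AddMonoidHom.mk' (fun x => (D₀.toDual x.1).comp π₀ + (D.toDual x.2).comp π₁) (by
      intro x y
      simp only [Prod.fst_add, Prod.snd_add, map_add, AddMonoidHom.add_comp]
      abel)
  have hT : ∀ (x : D₀.X × D.X) (s : Kobayashi2003.signedSelmerInfty V' κF 1),
      T x s = D₀.toDual x.1 (Φ s).1 + D.toDual x.2 (Φ s).2 := fun x s => rfl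
  have hTbij : Function.Bijective T :=
    bijective_dualOfProd Φ D₀.toDual D.toDual D₀.bijective D.bijective
  -- the dual datum of `Sel⁺(V'/F_∞)` on the module `D₀.X × D.X`
  let DF : Kobayashi2003.SignedSelmerDualData V' κF γF 1 :=
    { X := D₀.X × D.X
      conj_mem := fun s hs => Kobayashi2003.conjH1_mem_signedSelmerInfty V' κF 1 γF hs
      toDual := T
      bijective := hTbij
      toDual_T_smul := by
        intro x s
        have h0 : (Φ ⟨V'.conjH1 p κF.kerSubgroup γF s,
            Kobayashi2003.conjH1_mem_signedSelmerInfty V' κF 1 γF s.2⟩).1 =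
            ⟨V.conjH1 p κ.kerSubgroup γ (Φ s).1, D₀.conj_mem _ (Φ s).1.2⟩ :=
          Subtype.ext (hΦ s).1
        have h1 : (Φ ⟨V'.conjH1 p κF.kerSubgroup γF s,
            Kobayashi2003.conjH1_mem_signedSelmerInfty V' κF 1 γF s.2⟩).2 =
            ⟨V.conjH1 p (towerTopSubgroup κ K₀) γ (Φ s).2, D.conj_mem _ (Φ s).2.2⟩ :=
          Subtype.ext (hΦ s).2
        rw [hT, hT, hT, Prod.smul_fst, Prod.smul_snd, D₀.toDual_T_smul, D.toDual_T_smul, h0, h1]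
        abel
      toDual_C_smul := by
        intro c x s k hk
        have hk' : (p ^ k) • Φ s = 0 := by rw [← map_nsmul, hk, map_zero]
        have hk0 : (p ^ k) • (Φ s).1 = 0 := by
          have := congrArg Prod.fst hk'; simpa using this
        have hk1 : (p ^ k) • (Φ s).2 = 0 := by
          have := congrArg Prod.snd hk'; simpa using this
        rw [hT, hT, Prod.smul_fst, Prod.smul_snd, D₀.toDual_C_smul c x.1 _ k hk0,
          D.toDual_C_smul c x.2 _ k hk1, smul_add] }
  haveI hFfin : Module.Finite (IwasawaAlgebra p) DF.X :=
    inferInstanceAs (Module.Finite (IwasawaAlgebra p) (D₀.X × D.X))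
  have hFtor : Module.IsTorsion (IwasawaAlgebra p) DF.X :=
    Summit.BirchSwinnertonDyer.BirchSwinnertonDyer.Theorems.isTorsion_prod h0tor htor
  -- `Char X⁺(V'/F_∞) = Char X⁺(V/ℚ_∞) · Char X_η = (ξ · g)`
  obtain ⟨ξ, hξ⟩ := (charIdeal_isPrincipal_holds p D₀.X).principal
  have hξ' : D₀.charIdeal = Ideal.span {ξ} := hξ
  have hmul : DF.charIdeal = D₀.charIdeal * D.charIdeal :=
    charIdeal_mul_of_shortExact_holds p (D₀.X × D.X) hFtor (LinearMap.inl (IwasawaAlgebra p) D₀.X D.X)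
      (LinearMap.snd (IwasawaAlgebra p) D₀.X D.X) LinearMap.inl_injective LinearMap.snd_surjective
      .inl_snd
  have hcharF : DF.charIdeal = Ideal.span {ξ * g} := by
    rw [hmul, hξ', hg, Ideal.span_singleton_mul_span_singleton]
  -- the signed rank bound over `F`, and the rank of `V'(F)`
  have hFdvd : (PowerSeries.X : IwasawaAlgebra p) ^ V'.mordellWeilRank ∣ ξ * g :=
    DF.X_pow_mordellWeilRank_dvd_of_charIdeal_eq_span hγF hFtor hcharF
  rw [mordellWeilRank_model_eq_add V F V' hF2 hθ hCV] at hFdvd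
  -- the `V`-side WITHOUT surjectivity: `ξ ∣ pⁿ·L_p⁺(V)` (Thm. 1.3, `pⁿ`-clause) and `coeff_{rank V} L_p⁺(V) ≠ 0` bound `ord_T ξ ≤ rank V`
  obtain ⟨Lp, hLp, hcoefV⟩ := hcertV f hf
  obtain ⟨n, hn⟩ := (h13 V p hp2 hgood hap f hf κ γ hκ hγ hγc 1 Lp hLp D₀ h0tor).1
  have hξLp : ξ ∣ (p : IwasawaAlgebra p) ^ n * Lp := by
    rw [hξ'] at hn
    exact Ideal.mem_span_singleton.mp hn
  set rV := V.mordellWeilRank with hrV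
  set rW := (V.quadraticTwist ((-1) ^ (p / 2) * p)).mordellWeilRank with hrW
  by_cases hg0 : g = 0
  · rw [hg0]; exact dvd_zero _
  have hLp0 : Lp ≠ 0 := fun h ↦ hcoefV (by rw [h, map_zero])
  have hpL0 : (p : IwasawaAlgebra p) ^ n * Lp ≠ 0 := by
    rw [natCast_pow_eq_C_pow]
    exact mul_ne_zero (Summit.BirchSwinnertonDyer.Rank1Residual.X1.MuLambda.C_pow_ne_zero n) hLp0
  have hξ0 : ξ ≠ 0 := by
    rintro rfl
    obtain ⟨q, hq⟩ := hξLp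
    exact hpL0 (by rw [hq, zero_mul])
  -- `ord ξ ≤ rank V`
  have hξle : (PowerSeries.order ξ).toNat ≤ rV := by
    have h1 := order_toNat_le_of_dvd hpL0 hξLp
    rw [order_natCast_pow_mul] at h1
    have h2 : (PowerSeries.order Lp).toNat ≤ rV := by
      have h3 : PowerSeries.order Lp ≤ (rV : ℕ) := PowerSeries.order_le rV hcoefV
      simpa using ENat.toNat_le_toNat h3 (ENat.coe_ne_top rV)
    exact h1.trans h2
  -- `rank V + rank W ≤ ord ξ + ord g`
  have hsum : rV + rW ≤ (PowerSeries.order ξ).toNat + (PowerSeries.order g).toNat := by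
    obtain ⟨q, hq⟩ := hFdvd
    have h1 : (((rV + rW : ℕ) : ℕ∞)) ≤ PowerSeries.order (ξ * g) := by
      rw [hq, PowerSeries.order_mul, PowerSeries.order_X_pow]; exact le_self_add
    rw [PowerSeries.order_mul, ← PowerSeries.coe_toNat_order hξ0, ← PowerSeries.coe_toNat_order hg0, ← Nat.cast_add,
      Nat.cast_le] at h1
    exact h1
  have hge : rW ≤ (PowerSeries.order g).toNat := by omega
  refine ⟨PowerSeries.X ^ ((PowerSeries.order g).toNat - rW) * PowerSeries.divXPowOrder g, ?_⟩
  conv_lhs => rw [← PowerSeries.X_pow_order_mul_divXPowOrder (f := g)]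
  rw [← mul_assoc, ← pow_add, Nat.add_sub_cancel' hge]

/-! ## §113 The `r₀`-part of (C1⁺_η) on any row: `ord_T Char X^η = rank W = ord_T L_p⁺(V, η, X)` -/

/-- **THE `r₀`-PART OF THE `η`-MAIN CONJECTURE AT ANY ROW (onto or not).** GRANTED Kobayashi's Thm. 1.2, 1.3 (`pⁿ`-clause), 2.2η and
4.1η (`pⁿ`-clause) (NAMED facts), `coeff_{rank V} L_p⁺(V) ≠ 0`, and a branch function `Lη = L_p⁺(V, η, X)` vanishing at `T = 0` to order
EXACTLY `rank V^{(p*)}(ℚ)` (`hordL`, a numerical certificate: BSD-rank of the twist on the analytic side): every generator `g` of `Char X^η`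
has **`ord_T g = rank V^{(p*)}(ℚ) = ord_T Lη`** (`T^{rank W} ∣ g` by §112; `g ∣ pⁿLη` ⟹ `ord g ≤ ord Lη`). CONDITIONAL; asserts nothing class-wide.
[cite: Kobayashi2003, Thm. 1.2 and Thm. 1.3 (p. 2), Thm. 2.2 (p. 5), Thm. 4.1 (p. 8)] [cite: GreenbergLNM1716, §3 Lemma 3.1] -/
theorem order_etaCharGenerator_eq_twistRank_of_namedFacts
    (h12 : Kobayashi2003.thm12_signedSelmerDual_finite_torsion)
    (h13 : Kobayashi2003.thm41_signedCharIdeal_divisibility)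
    (h22 : Kobayashi2003.thm22_etaSignedSelmerDual_finite_torsion)
    (h41 : Kobayashi2003.thm41_plusEtaCharIdeal_dvd)
    (hp5 : 5 ≤ p) (hgood : V.HasGoodReductionAtPrime p) (hap : V.frobeniusTrace p = 0)
    (hcertV : ∀ {N : ℕ} [NeZero N] (f : CuspForm (Gamma0 N) 2), IsNewformOf V f →
      ∃ L : IwasawaAlgebra p, Kobayashi2003.IsSignedPAdicLFunction f p 1 L ∧
        PowerSeries.coeff V.mordellWeilRank L ≠ 0)
    {N : ℕ} [NeZero N] {f : CuspForm (Gamma0 N) 2} (hf : IsNewformOf V f) (ϖ : ℚ)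
    (hϖ : if Even (p / 2) then (ϖ : ℝ) * V.realPeriodRat = plusPeriod f
      else (ϖ : ℝ) * V.imaginaryPeriodRat = minusPeriod f)
    (Lη : IwasawaAlgebra p) (hL : IsQuadraticBranchPlusLFunction f p ϖ Lη)
    (hordL : (PowerSeries.order Lη).toNat = (V.quadraticTwist ((-1) ^ (p / 2) * p)).mordellWeilRank) (hL0 : Lη ≠ 0)
    (K₀ : Type) [Field K₀] [NumberField K₀] [IsCyclotomicExtension {p} ℚ K₀]
    [(galRange (K := ℚ) K₀).Normal] (ηq : absoluteGaloisGroup ℚ →* ℤˣ)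
    (hηK : ∀ σ ∈ galRange (K := ℚ) K₀, ηq σ = 1) (hη1 : ηq ≠ 1)
    (κ : ZpExtension ℚ p) (γ : absoluteGaloisGroup ℚ) (hκ : κ.IsCyclotomic) (hγ : κ.IsTopGenerator γ)
    (hγK : γ ∈ galRange (K := ℚ) K₀) (hγc : IsCyclotomicVariable p γ)
    (D : EtaSignedSelmerDualData V κ K₀ ℚ_[p] ηq γ 1) {g : IwasawaAlgebra p}
    (hg : D.charIdeal = Ideal.span {g}) :
    (PowerSeries.order g).toNat = (V.quadraticTwist ((-1) ^ (p / 2) * p)).mordellWeilRank ∧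
      (PowerSeries.order g).toNat = (PowerSeries.order Lη).toNat := by
  have hp2 : p ≠ 2 := by omega
  have hXg := X_pow_twistRank_dvd_etaCharGenerator_of_namedFacts_of_coeff_ne_zero h12 h13 h22 hp5 hgood hap
    (fun f hf => hcertV f hf) hf K₀ ηq hηK hη1 κ γ hκ hγ hγK hγc D hg
  -- Kato side with slack: `g ∣ pⁿ·Lη`
  obtain ⟨hfin, htor⟩ :=
    EtaSignedSelmerDualData.finite_isTorsion_of_thm22 h22 hηK hp2 hgood hap hκ hγ hγK D
  obtain ⟨⟨n, hn⟩, -⟩ := h41 p K₀ ηq hηK hη1 V hp2 hgood hap hf ϖ hϖ Lη hL κ γ hκ hγ hγK hγc D.toLiterature hfin htor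
  rw [EtaSignedSelmerDualData.charIdeal_toLiterature, hg, Ideal.mem_span_singleton] at hn
  have hpL0 : (p : IwasawaAlgebra p) ^ n * Lη ≠ 0 := by
    rw [natCast_pow_eq_C_pow]
    exact mul_ne_zero (Summit.BirchSwinnertonDyer.Rank1Residual.X1.MuLambda.C_pow_ne_zero n) hL0
  have hg0 : g ≠ 0 := by
    rintro rfl
    obtain ⟨q, hq⟩ := hn
    exact hpL0 (by rw [hq, zero_mul])
  have hle : (PowerSeries.order g).toNat ≤ (PowerSeries.order Lη).toNat := by
    have h1 := order_toNat_le_of_dvd hpL0 hn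
    rwa [order_natCast_pow_mul] at h1
  have hge : (V.quadraticTwist ((-1) ^ (p / 2) * p)).mordellWeilRank ≤ (PowerSeries.order g).toNat := by
    obtain ⟨q, hq⟩ := hXg
    have h1 : ((((V.quadraticTwist ((-1) ^ (p / 2) * p)).mordellWeilRank : ℕ)) : ℕ∞) ≤ PowerSeries.order g := by
      rw [hq, PowerSeries.order_mul, PowerSeries.order_X_pow]; exact le_self_add
    simpa using ENat.toNat_le_toNat h1 ((PowerSeries.order_finite_iff_ne_zero.mpr hg0).ne)
  omega

/-! ## §114 (C1⁺_η) up to a power of `p` at a (possibly non-onto) pair -/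

/-- **THE `η`-MAIN CONJECTURE UP TO `p^{μ_alg}` AT ANY ROW (onto or not) — crux 19606's rows.** GRANTED Kobayashi's Thm. 1.2, 1.3 (`pⁿ`-clause),
2.2η, 4.1η (`pⁿ`-clause) and B. D. Kim's Thm. 3.11η (NAMED facts, hypothesis position), `p ≥ 5` good with `a_p = 0`,
`coeff_{rank V} L_p⁺(V) ≠ 0`, the ANALYTIC NORM SHAPE `Lη = u·T^{rank W}·(1+T)^{deg H}·H(T + ιT)` with `H ∈ ℤ_p[Z]` distinguished IRREDUCIBLE,
`H(0) ≠ 0` (`W = V^{(p*)}`; `μ_an = 0`, `ord = rank W`, `λ_an = rank W + 2 deg H`), and ONE ALGEBRAIC ZERO PAIR `rank W < λ(g)` for the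
generator: **`Char X^η(D) = (p^{μ(g)}·Lη)` and `μ(g) ≤ n`** (Thm. 4.1η's `n`). In words: the characteristic ideal of the `η`-datum IS the
analytic ideal up to the factor `p^{μ_alg}`; (C1⁺_η) at this datum ⟺ `μ_alg = 0`. CONDITIONAL on the displayed inputs; certifies no row by itself;
the crux stays OPEN. [cite: Kobayashi2003, Thm. 1.2/1.3 (p. 2), Thm. 2.2 (p. 5), §4 + Thm. 4.1 (p. 8)] [cite: KimBD2008MRL, Thm. 3.11 (p. 93)]
[cite: GreenbergVatsal2000, p. 4 (after Thm. (1.2))] -/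
theorem etaCharIdeal_eq_span_C_pow_mul_of_namedFacts_of_invol_of_normShape_of_lt_lam
    (h12 : Kobayashi2003.thm12_signedSelmerDual_finite_torsion)
    (h13 : Kobayashi2003.thm41_signedCharIdeal_divisibility)
    (h22 : Kobayashi2003.thm22_etaSignedSelmerDual_finite_torsion)
    (h41 : Kobayashi2003.thm41_plusEtaCharIdeal_dvd)
    (hFE : Kim2008.thm311_etaSignedSelmerDual_charIdeal_map_invol)
    (hp5 : 5 ≤ p) (hgood : V.HasGoodReductionAtPrime p) (hap : V.frobeniusTrace p = 0)
    (hcertV : ∀ {N : ℕ} [NeZero N] (f : CuspForm (Gamma0 N) 2), IsNewformOf V f →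
      ∃ L : IwasawaAlgebra p, Kobayashi2003.IsSignedPAdicLFunction f p 1 L ∧
        PowerSeries.coeff V.mordellWeilRank L ≠ 0)
    {N : ℕ} [NeZero N] {f : CuspForm (Gamma0 N) 2} (hf : IsNewformOf V f) (ϖ : ℚ)
    (hϖ : if Even (p / 2) then (ϖ : ℝ) * V.realPeriodRat = plusPeriod f
      else (ϖ : ℝ) * V.imaginaryPeriodRat = minusPeriod f)
    (Lη : IwasawaAlgebra p) (hL : IsQuadraticBranchPlusLFunction f p ϖ Lη)
    {u : IwasawaAlgebra p} {H : Polynomial ℤ_[p]} (hu : IsUnit u) (hH : H.IsDistinguishedAt (IsLocalRing.maximalIdeal ℤ_[p]))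
    (hirr : Irreducible H) (hH0 : H.coeff 0 ≠ 0)
    (hLs : Lη = u * PowerSeries.X ^ (V.quadraticTwist ((-1) ^ (p / 2) * p)).mordellWeilRank *
      ((1 + PowerSeries.X) ^ H.natDegree * PowerSeries.subst (PowerSeries.X + invol p PowerSeries.X) (H : IwasawaAlgebra p)))
    (K₀ : Type) [Field K₀] [NumberField K₀] [IsCyclotomicExtension {p} ℚ K₀]
    [(galRange (K := ℚ) K₀).Normal] (ηq : absoluteGaloisGroup ℚ →* ℤˣ)
    (hηK : ∀ σ ∈ galRange (K := ℚ) K₀, ηq σ = 1) (hη1 : ηq ≠ 1)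
    (κ : ZpExtension ℚ p) (γ : absoluteGaloisGroup ℚ) (hκ : κ.IsCyclotomic) (hγ : κ.IsTopGenerator γ)
    (hγK : γ ∈ galRange (K := ℚ) K₀) (hγc : IsCyclotomicVariable p γ)
    (D : EtaSignedSelmerDualData V κ K₀ ℚ_[p] ηq γ 1) {g : IwasawaAlgebra p}
    (hg : D.charIdeal = Ideal.span {g}) (hlam : (V.quadraticTwist ((-1) ^ (p / 2) * p)).mordellWeilRank < lam g) :
    ∃ n : ℕ, mu g ≤ n ∧ lam g = (V.quadraticTwist ((-1) ^ (p / 2) * p)).mordellWeilRank + 2 * H.natDegree ∧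
      D.charIdeal = Ideal.span {PowerSeries.C ((p : ℤ_[p]) ^ mu g) * Lη} := by
  have hp2 : p ≠ 2 := by omega
  have hXg := X_pow_twistRank_dvd_etaCharGenerator_of_namedFacts_of_coeff_ne_zero h12 h13 h22 hp5 hgood hap
    (fun f hf => hcertV f hf) hf K₀ ηq hηK hη1 κ γ hκ hγ hγK hγc D hg
  -- Kato side with slack: `g ∣ pⁿ·Lη`
  obtain ⟨hfin, htor⟩ :=
    EtaSignedSelmerDualData.finite_isTorsion_of_thm22 h22 hηK hp2 hgood hap hκ hγ hγK D
  obtain ⟨⟨n, hn⟩, -⟩ := h41 p K₀ ηq hηK hη1 V hp2 hgood hap hf ϖ hϖ Lη hL κ γ hκ hγ hγK hγc D.toLiterature hfin htor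
  rw [EtaSignedSelmerDualData.charIdeal_toLiterature, hg, natCast_pow_mul_mem_span_singleton_iff] at hn
  -- the algebraic functional equation at `η` (B. D. Kim Thm. 3.11): `(g)` is `ι`-stable
  have hι : Ideal.span {invol p g} = Ideal.span {g} := by
    have h := hFE p K₀ ηq hηK V (by omega) hgood hap κ γ hκ hγ hγK 1 D.toLiterature
    rw [EtaSignedSelmerDualData.charIdeal_toLiterature] at h
    exact span_invol_eq_of_map_invol_eq h hg
  -- Part XXXV's slack brick
  obtain ⟨r, hr⟩ := exists_two_mul_eq_neg_one (p := p) hp2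
  obtain ⟨hmu, -, hlam', hspan⟩ := span_eq_C_pow_mul_of_normShape_of_irreducible_of_lt_lam hr
    (S := PowerSeries.X * PowerSeries.binomialSeries ℤ_[p] r) rfl (Z := PowerSeries.X + invol p PowerSeries.X) rfl hu hH hirr hH0 hLs
    hXg hn hι hlam
  exact ⟨n, hmu, hlam', by rw [hg, hspan]⟩

/-- **`μ_alg = 0` closes the datum.** Under the hypotheses of the previous theorem, if moreover `μ(g) = 0` then `Char X^η(D) = (Lη)` — the
conclusion of (C1⁺_η) for this datum (together with Thm. 2.2η's finiteness/torsion). CONDITIONAL. [cite: Kobayashi2003, §4 Even main conjecture (p. 8)]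
[cite: KimBD2008MRL, Thm. 3.11 (p. 93)] -/
theorem etaCharIdeal_eq_span_of_namedFacts_of_invol_of_normShape_of_lt_lam_of_mu
    (h12 : Kobayashi2003.thm12_signedSelmerDual_finite_torsion)
    (h13 : Kobayashi2003.thm41_signedCharIdeal_divisibility)
    (h22 : Kobayashi2003.thm22_etaSignedSelmerDual_finite_torsion)
    (h41 : Kobayashi2003.thm41_plusEtaCharIdeal_dvd)
    (hFE : Kim2008.thm311_etaSignedSelmerDual_charIdeal_map_invol)
    (hp5 : 5 ≤ p) (hgood : V.HasGoodReductionAtPrime p) (hap : V.frobeniusTrace p = 0)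
    (hcertV : ∀ {N : ℕ} [NeZero N] (f : CuspForm (Gamma0 N) 2), IsNewformOf V f →
      ∃ L : IwasawaAlgebra p, Kobayashi2003.IsSignedPAdicLFunction f p 1 L ∧
        PowerSeries.coeff V.mordellWeilRank L ≠ 0)
    {N : ℕ} [NeZero N] {f : CuspForm (Gamma0 N) 2} (hf : IsNewformOf V f) (ϖ : ℚ)
    (hϖ : if Even (p / 2) then (ϖ : ℝ) * V.realPeriodRat = plusPeriod f
      else (ϖ : ℝ) * V.imaginaryPeriodRat = minusPeriod f)
    (Lη : IwasawaAlgebra p) (hL : IsQuadraticBranchPlusLFunction f p ϖ Lη)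
    {u : IwasawaAlgebra p} {H : Polynomial ℤ_[p]} (hu : IsUnit u) (hH : H.IsDistinguishedAt (IsLocalRing.maximalIdeal ℤ_[p]))
    (hirr : Irreducible H) (hH0 : H.coeff 0 ≠ 0)
    (hLs : Lη = u * PowerSeries.X ^ (V.quadraticTwist ((-1) ^ (p / 2) * p)).mordellWeilRank *
      ((1 + PowerSeries.X) ^ H.natDegree * PowerSeries.subst (PowerSeries.X + invol p PowerSeries.X) (H : IwasawaAlgebra p)))
    (K₀ : Type) [Field K₀] [NumberField K₀] [IsCyclotomicExtension {p} ℚ K₀]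
    [(galRange (K := ℚ) K₀).Normal] (ηq : absoluteGaloisGroup ℚ →* ℤˣ)
    (hηK : ∀ σ ∈ galRange (K := ℚ) K₀, ηq σ = 1) (hη1 : ηq ≠ 1)
    (κ : ZpExtension ℚ p) (γ : absoluteGaloisGroup ℚ) (hκ : κ.IsCyclotomic) (hγ : κ.IsTopGenerator γ)
    (hγK : γ ∈ galRange (K := ℚ) K₀) (hγc : IsCyclotomicVariable p γ)
    (D : EtaSignedSelmerDualData V κ K₀ ℚ_[p] ηq γ 1) {g : IwasawaAlgebra p}
    (hg : D.charIdeal = Ideal.span {g}) (hlam : (V.quadraticTwist ((-1) ^ (p / 2) * p)).mordellWeilRank < lam g) (hmu : mu g = 0) :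
    D.charIdeal = Ideal.span {Lη} := by
  obtain ⟨-, -, -, hspan⟩ := etaCharIdeal_eq_span_C_pow_mul_of_namedFacts_of_invol_of_normShape_of_lt_lam h12 h13 h22 h41 hFE hp5
    hgood hap (fun f hf => hcertV f hf) hf ϖ hϖ Lη hL hu hH hirr hH0 hLs K₀ ηq hηK hη1 κ γ hκ hγ hγK hγc D hg hlam
  rw [hspan, hmu, pow_zero, map_one, one_mul]

end Pair

end Summit.BirchSwinnertonDyer.BirchSwinnertonDyer.Theorems.EtaThetaFunctionalEquation

end
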